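import Literature.Combinatorics.LorentzianPolynomials.Rayleigh
import Literature.Combinatorics.LorentzianPolynomials.Substitution
import HarnessLib

/-!
# Operations preserving `c`-Rayleigh polynomials: contraction, deletion, dilation, translation
# (Brändén–Huh 2020, §2.4 Lemma 2.20 (1), (2), (4), (5))

Layer `Literature/Combinatorics/LorentzianPolynomials`, namespace `Literature.Combinatorics.LorentzianPolynomials`;
lane `lit-hodgefound` (Track 2 foundations library), seat p16, generation 27 (row g27-#17). Builds on `Rayleigh.lean`
(`IsCRayleigh`, Def. 2.18) and `Substitution.lean` (`diagScale`, the dilation `f(a_1 w_1, …, a_n w_n)`).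

## Source (verbatim) — P. Brändén, J. Huh, *Lorentzian polynomials* [BrandenHuh2019] (held `paper:arxiv-1902.03719`)

§2.4: "We prepare the proof of Theorem 2.23 with three lemmas. Verification of the first lemma is routine and will be
omitted. **Lemma 2.20.** The following polynomials are `c`-Rayleigh whenever `f` is `c`-Rayleigh: (1) The contraction
`∂_i f` of `f`. (2) The deletion `f ∖ i` of `f`, the polynomial obtained from `f` by evaluating `w_i = 0`. (3) The
diagonalization `f(w_1, w_1, w_3, …, w_n)`. (4) The dilation `f(a_1 w_1, …, a_n w_n)`, for `(a_1, …, a_n) ∈ ℝ^n_{≥0}`.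
(5) The translation `f(a_1 + w_1, …, a_n + w_n)`, for `(a_1, …, a_n) ∈ ℝ^n_{≥0}`."

## What is here (the omitted routine verifications of (1), (2), (4), (5))

* §1 (1) contraction: `iterPderiv_pderiv` (`∂^α ∂_i f = ∂^{α+e_i} f`), `iterPderiv_iterPderiv` (`∂^α ∂^β = ∂^{α+β}`),
  **`IsCRayleigh.pderiv`**, `IsCRayleigh.iterPderiv`.
* §2 (4) dilation: `iterPderiv_diagScale` (`∂^α [f(a·w)] = a^α (∂^α f)(a·w)`), **`IsCRayleigh.diagScale`**; (2) deletion as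
  the dilation by the indicator of `σ ∖ {i}`: `deletion i f`, `eval_deletion` (`= f(w)|_{w_i = 0}`), `coeff_deletion`,
  **`IsCRayleigh.deletion`**.
* §3 (5) translation: `translate a f = f(w + a)` (Mathlib's `bind₁ (X_i + C a_i)`), `eval_translate`, `pderiv_translate`,
  `iterPderiv_translate`, `coeff_translate_nonneg` (nonnegative coefficients are kept when `a ≥ 0`),
  **`IsCRayleigh.translate`**.

Two definitions with bodies (`deletion`, `translate`), theorems otherwise; no `sorry`, no named fact. Item (3)
(diagonalization) is not treated here. -- TODO(general form): Lemma 2.20 (3), the diagonalization `f(w_1, w_1, w_3, …)`.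

## References

* [BrandenHuh2019] P. Brändén, J. Huh, *Lorentzian polynomials*, Ann. of Math. (2) 192 (2020) 821–891, arXiv:1902.03719 —
  §2.4 Lemma 2.20.
-/

noncomputable section

open MvPolynomial Finsupp Finset

namespace Literature.Combinatorics.LorentzianPolynomials

variable {σ : Type*} [Fintype σ]

/-! ## §1 Contraction `∂_i f` (Lemma 2.20 (1)) -/

section Contraction

/-- `∂^α (∂_i f) = ∂^{α + e_i} f`. [cite: BrandenHuh2019, §2.1 (p. 8, "`∂^α = ∂_1^{α_1} ⋯ ∂_n^{α_n}`")] -/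
theorem iterPderiv_pderiv (α : σ →₀ ℕ) (i : σ) (f : MvPolynomial σ ℝ) :
    iterPderiv α (pderiv i f) = iterPderiv (α + Finsupp.single i 1) f :=
  (iterPderiv_add_single' α i f).symm

/-- `∂^α (∂^β f) = ∂^{α + β} f`. [cite: BrandenHuh2019, §2.1 (p. 8, "`∂^α = ∂_1^{α_1} ⋯ ∂_n^{α_n}`")] -/
theorem iterPderiv_iterPderiv (α β : σ →₀ ℕ) (f : MvPolynomial σ ℝ) :
    iterPderiv α (iterPderiv β f) = iterPderiv (α + β) f := by
  classical
  obtain ⟨n, hn⟩ : ∃ n, β.degree = n := ⟨_, rfl⟩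
  induction n generalizing α β with
  | zero =>
    rw [Finsupp.degree_eq_zero_iff] at hn
    rw [hn, iterPderiv_zero, add_zero]
  | succ n ih =>
    have hβ0 : β ≠ 0 := fun h ↦ by rw [h, map_zero] at hn; exact Nat.succ_ne_zero n hn.symm
    obtain ⟨i, hi⟩ : ∃ i, β i ≠ 0 := by
      by_contra h
      push Not at h
      exact hβ0 (Finsupp.ext h)
    have hsplit : β = (β - Finsupp.single i 1) + Finsupp.single i 1 := by
      ext k
      rw [Finsupp.add_apply, Finsupp.tsub_apply, Finsupp.single_apply]
      split_ifs with hk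
      · subst hk; omega
      · omega
    have hdeg : (β - Finsupp.single i 1).degree = n := by
      have h := degree_sub_single_add_one hi
      omega
    rw [hsplit, iterPderiv_add_single, iterPderiv_pderiv, ih (α + Finsupp.single i 1) (β - Finsupp.single i 1) hdeg,
      add_assoc, add_comm (Finsupp.single i 1) (β - Finsupp.single i 1)]

/-- **Lemma 2.20 (1): the contraction `∂_i f` of a `c`-Rayleigh polynomial is `c`-Rayleigh** (`∂^α ∂_i f = ∂^{α+e_i} f`,
and `∂_i` keeps nonnegative coefficients). [cite: BrandenHuh2019, §2.4 Lemma 2.20 (1)] -/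
theorem IsCRayleigh.pderiv {c : ℝ} {f : MvPolynomial σ ℝ} (h : IsCRayleigh c f) (i : σ) : IsCRayleigh c (pderiv i f) := by
  refine ⟨fun β ↦ coeff_pderiv_nonneg h.1 i β, fun α a b w hw ↦ ?_⟩
  have e1 : α + Finsupp.single a 1 + Finsupp.single b 1 + Finsupp.single i 1 =
      α + Finsupp.single i 1 + Finsupp.single a 1 + Finsupp.single b 1 := by abel
  have e2 : α + Finsupp.single a 1 + Finsupp.single i 1 = α + Finsupp.single i 1 + Finsupp.single a 1 := by abel
  have e3 : α + Finsupp.single b 1 + Finsupp.single i 1 = α + Finsupp.single i 1 + Finsupp.single b 1 := by abel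
  rw [iterPderiv_pderiv, iterPderiv_pderiv, iterPderiv_pderiv, iterPderiv_pderiv, e1, e2, e3]
  exact h.le (α + Finsupp.single i 1) a b hw

/-- Iterating (1): `∂^β f` is `c`-Rayleigh whenever `f` is. [cite: BrandenHuh2019, §2.4 Lemma 2.20 (1)] -/
theorem IsCRayleigh.iterPderiv {c : ℝ} {f : MvPolynomial σ ℝ} (h : IsCRayleigh c f) (β : σ →₀ ℕ) :
    IsCRayleigh c (iterPderiv β f) := by
  refine ⟨fun γ ↦ coeff_iterPderiv_nonneg h.1 β γ, fun α a b w hw ↦ ?_⟩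
  have e1 : α + Finsupp.single a 1 + Finsupp.single b 1 + β = α + β + Finsupp.single a 1 + Finsupp.single b 1 := by abel
  have e2 : α + Finsupp.single a 1 + β = α + β + Finsupp.single a 1 := by abel
  have e3 : α + Finsupp.single b 1 + β = α + β + Finsupp.single b 1 := by abel
  rw [iterPderiv_iterPderiv, iterPderiv_iterPderiv, iterPderiv_iterPderiv, iterPderiv_iterPderiv, e1, e2, e3]
  exact h.le (α + β) a b hw

end Contraction

/-! ## §2 Dilation `f(a_1 w_1, …, a_n w_n)` and deletion `f ∖ i` (Lemma 2.20 (4), (2)) -/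

section Dilation

variable [DecidableEq σ]

omit [Fintype σ] [DecidableEq σ] in
/-- `a^{α + β} = a^α a^β`. [cite: BrandenHuh2019, §2.4 Lemma 2.20 (4)] -/
private theorem prod_pow_add [Fintype σ] (a : σ → ℝ) (α β : σ →₀ ℕ) :
    (∏ i, a i ^ (α + β) i) = (∏ i, a i ^ α i) * ∏ i, a i ^ β i := by
  rw [← Finset.prod_mul_distrib]
  exact Finset.prod_congr rfl fun i _ ↦ by rw [Finsupp.add_apply, pow_add]

omit [Fintype σ] [DecidableEq σ] in
/-- `a^α ≥ 0` for `a ≥ 0`. [cite: BrandenHuh2019, §2.4 Lemma 2.20 (4)] -/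
private theorem prod_pow_nonneg' [Fintype σ] {a : σ → ℝ} (ha : ∀ i, 0 ≤ a i) (α : σ →₀ ℕ) : 0 ≤ ∏ i, a i ^ α i :=
  Finset.prod_nonneg fun i _ ↦ pow_nonneg (ha i) _

/-- **The chain rule for a dilation**: `∂^α [f(a·w)] = a^α · (∂^α f)(a·w)`. [cite: BrandenHuh2019, §2.4 Lemma 2.20 (4)] -/
theorem iterPderiv_diagScale (a : σ → ℝ) (α : σ →₀ ℕ) (f : MvPolynomial σ ℝ) :
    iterPderiv α (diagScale a f) = (∏ i, a i ^ α i) • diagScale a (iterPderiv α f) := by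
  ext β
  rw [coeff_iterPderiv, coeff_diagScale, coeff_smul, coeff_diagScale, coeff_iterPderiv, smul_eq_mul, prod_pow_add]
  ring

/-- The dilation of a polynomial with nonnegative coefficients by `a ≥ 0` has nonnegative coefficients.
[cite: BrandenHuh2019, §2.4 Lemma 2.20 (4)] -/
theorem coeff_diagScale_nonneg {a : σ → ℝ} (ha : ∀ i, 0 ≤ a i) {f : MvPolynomial σ ℝ} (hnn : ∀ α, 0 ≤ coeff α f)
    (β : σ →₀ ℕ) : 0 ≤ coeff β (diagScale a f) := by
  rw [coeff_diagScale]
  exact mul_nonneg (prod_pow_nonneg' ha β) (hnn β)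

/-- **Lemma 2.20 (4): the dilation `f(a_1 w_1, …, a_n w_n)`, `a ∈ ℝ^n_{≥0}`, of a `c`-Rayleigh polynomial is
`c`-Rayleigh** (both sides of Def. 2.18 for the dilation at `w` are `a^{2α+e_i+e_j}` times those for `f` at `a·w ≥ 0`).
[cite: BrandenHuh2019, §2.4 Lemma 2.20 (4)] -/
theorem IsCRayleigh.diagScale {c : ℝ} {f : MvPolynomial σ ℝ} (h : IsCRayleigh c f) {a : σ → ℝ} (ha : ∀ i, 0 ≤ a i) :
    IsCRayleigh c (diagScale a f) := by
  refine ⟨coeff_diagScale_nonneg ha h.1, fun α i j w hw ↦ ?_⟩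
  have haw : ∀ k, 0 ≤ a k * w k := fun k ↦ mul_nonneg (ha k) (hw k)
  have h' := h.le α i j haw
  simp only [iterPderiv_diagScale, smul_eval, eval_diagScale]
  have hpow : (∏ k, a k ^ α k) * ∏ k, a k ^ (α + Finsupp.single i 1 + Finsupp.single j 1 : σ →₀ ℕ) k =
      (∏ k, a k ^ (α + Finsupp.single i 1 : σ →₀ ℕ) k) * ∏ k, a k ^ (α + Finsupp.single j 1 : σ →₀ ℕ) k := by
    simp only [prod_pow_add]
    ring
  have hP : 0 ≤ (∏ k, a k ^ (α + Finsupp.single i 1 : σ →₀ ℕ) k) * ∏ k, a k ^ (α + Finsupp.single j 1 : σ →₀ ℕ) k :=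
    mul_nonneg (prod_pow_nonneg' ha _) (prod_pow_nonneg' ha _)
  calc (∏ k, a k ^ α k) * eval (fun k ↦ a k * w k) (LorentzianPolynomials.iterPderiv α f) *
        ((∏ k, a k ^ (α + Finsupp.single i 1 + Finsupp.single j 1 : σ →₀ ℕ) k) *
          eval (fun k ↦ a k * w k) (LorentzianPolynomials.iterPderiv (α + Finsupp.single i 1 + Finsupp.single j 1) f))
      = ((∏ k, a k ^ (α + Finsupp.single i 1 : σ →₀ ℕ) k) * ∏ k, a k ^ (α + Finsupp.single j 1 : σ →₀ ℕ) k) *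
          (eval (fun k ↦ a k * w k) (LorentzianPolynomials.iterPderiv α f) *
            eval (fun k ↦ a k * w k) (LorentzianPolynomials.iterPderiv (α + Finsupp.single i 1 + Finsupp.single j 1) f)) := by
        rw [← hpow]; ring
    _ ≤ ((∏ k, a k ^ (α + Finsupp.single i 1 : σ →₀ ℕ) k) * ∏ k, a k ^ (α + Finsupp.single j 1 : σ →₀ ℕ) k) *
          (c * (eval (fun k ↦ a k * w k) (LorentzianPolynomials.iterPderiv (α + Finsupp.single i 1) f) *
            eval (fun k ↦ a k * w k) (LorentzianPolynomials.iterPderiv (α + Finsupp.single j 1) f))) :=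
        mul_le_mul_of_nonneg_left h' hP
    _ = c * ((∏ k, a k ^ (α + Finsupp.single i 1 : σ →₀ ℕ) k) * eval (fun k ↦ a k * w k) (LorentzianPolynomials.iterPderiv (α + Finsupp.single i 1) f) *
          ((∏ k, a k ^ (α + Finsupp.single j 1 : σ →₀ ℕ) k) *
            eval (fun k ↦ a k * w k) (LorentzianPolynomials.iterPderiv (α + Finsupp.single j 1) f))) := by ring

/-- **The deletion `f ∖ i`**: "the polynomial obtained from `f` by evaluating `w_i = 0`", realised as the dilation by the
indicator of `σ ∖ {i}` (so it keeps the variable set `σ`). [cite: BrandenHuh2019, §2.4 Lemma 2.20 (2)] -/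
def deletion (i : σ) (f : MvPolynomial σ ℝ) : MvPolynomial σ ℝ := diagScale (fun k ↦ if k = i then 0 else 1) f

/-- `deletion i f` is the dilation by the indicator of `σ ∖ {i}`. [cite: BrandenHuh2019, §2.4 Lemma 2.20 (2), (4)] -/
theorem deletion_def (i : σ) (f : MvPolynomial σ ℝ) : deletion i f = diagScale (fun k ↦ if k = i then 0 else 1) f := rfl

/-- `(f ∖ i)(w) = f(w_1, …, w_{i-1}, 0, w_{i+1}, …)` ("evaluating `w_i = 0`"). [cite: BrandenHuh2019, §2.4 Lemma 2.20 (2)] -/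
theorem eval_deletion (i : σ) (f : MvPolynomial σ ℝ) (w : σ → ℝ) :
    eval w (deletion i f) = eval (Function.update w i 0) f := by
  have hw : (fun k ↦ (if k = i then (0 : ℝ) else 1) * w k) = Function.update w i 0 := by
    ext k
    by_cases hk : k = i
    · subst hk; rw [if_pos rfl, zero_mul, Function.update_self]
    · rw [if_neg hk, one_mul, Function.update_of_ne hk]
  rw [deletion, eval_diagScale, hw]

/-- The coefficients of `f ∖ i`: those of `f` at exponents not involving `w_i`, and `0` otherwise.
[cite: BrandenHuh2019, §2.4 Lemma 2.20 (2)] -/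
theorem coeff_deletion (i : σ) (f : MvPolynomial σ ℝ) (β : σ →₀ ℕ) :
    coeff β (deletion i f) = if β i = 0 then coeff β f else 0 := by
  rw [deletion, coeff_diagScale]
  split_ifs with hβ
  · rw [Finset.prod_eq_one fun k _ ↦ ?_, one_mul]
    by_cases hk : k = i
    · subst hk; rw [hβ, pow_zero]
    · rw [if_neg hk, one_pow]
  · rw [Finset.prod_eq_zero (Finset.mem_univ i) (by rw [if_pos rfl, zero_pow hβ]), zero_mul]

/-- **Lemma 2.20 (2): the deletion `f ∖ i` of a `c`-Rayleigh polynomial is `c`-Rayleigh** (a dilation by a vector in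
`{0,1}^n ⊆ ℝ^n_{≥0}`). [cite: BrandenHuh2019, §2.4 Lemma 2.20 (2)] -/
theorem IsCRayleigh.deletion {c : ℝ} {f : MvPolynomial σ ℝ} (h : IsCRayleigh c f) (i : σ) : IsCRayleigh c (deletion i f) :=
  h.diagScale fun k ↦ by by_cases hk : k = i <;> simp [hk]

end Dilation

/-! ## §3 Translation `f(a_1 + w_1, …, a_n + w_n)` (Lemma 2.20 (5)) -/

section Translation

/-- **The translation `f(a + w)`** of `f` by `a ∈ ℝ^n`: substitute `w_i ↦ w_i + a_i` (Mathlib's `bind₁`).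
[cite: BrandenHuh2019, §2.4 Lemma 2.20 (5)] -/
def translate (a : σ → ℝ) (f : MvPolynomial σ ℝ) : MvPolynomial σ ℝ := bind₁ (fun i ↦ X i + C (a i)) f

omit [Fintype σ] in
/-- `translate a f = bind₁ (X_i + C a_i) f`. [cite: BrandenHuh2019, §2.4 Lemma 2.20 (5)] -/
theorem translate_def (a : σ → ℝ) (f : MvPolynomial σ ℝ) : translate a f = bind₁ (fun i ↦ X i + C (a i)) f := rfl

omit [Fintype σ] in
/-- `f(a + w)` evaluated: `(translate a f)(w) = f(w + a)`. [cite: BrandenHuh2019, §2.4 Lemma 2.20 (5)] -/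
theorem eval_translate (a : σ → ℝ) (f : MvPolynomial σ ℝ) (w : σ → ℝ) :
    eval w (translate a f) = eval (fun i ↦ w i + a i) f := by
  rw [translate]
  have h := eval₂Hom_bind₁ (RingHom.id ℝ) w (fun i ↦ X i + C (a i)) f
  have hpt : (fun i ↦ eval₂Hom (RingHom.id ℝ) w (X i + C (a i))) = fun i ↦ w i + a i := by
    ext i; simp
  rw [hpt] at h
  exact h

omit [Fintype σ] in
/-- Translation is additive and multiplicative (an algebra map). [cite: BrandenHuh2019, §2.4 Lemma 2.20 (5)] -/
theorem translate_add (a : σ → ℝ) (f g : MvPolynomial σ ℝ) : translate a (f + g) = translate a f + translate a g :=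
  map_add _ f g

omit [Fintype σ] in
/-- **Translation commutes with `∂_i`**: `∂_i [f(w + a)] = (∂_i f)(w + a)`. [cite: BrandenHuh2019, §2.4 Lemma 2.20 (5)] -/
theorem pderiv_translate (a : σ → ℝ) (i : σ) (f : MvPolynomial σ ℝ) :
    pderiv i (translate a f) = translate a (pderiv i f) := by
  classical
  set T : MvPolynomial σ ℝ →ₐ[ℝ] MvPolynomial σ ℝ := bind₁ (fun i ↦ X i + C (a i)) with hT
  have htr : ∀ q : MvPolynomial σ ℝ, translate a q = T q := fun q ↦ rfl
  induction f using MvPolynomial.induction_on with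
  | C r => rw [htr, htr, hT, bind₁_C_right, pderiv_C, map_zero]
  | add p q hp hq => rw [translate_add, map_add, map_add, translate_add, hp, hq]
  | mul_X p k hp =>
    rw [htr, htr] at *
    have hX : pderiv i (X k + C (a k) : MvPolynomial σ ℝ) = T (pderiv i (X k)) := by
      rw [map_add, pderiv_C, add_zero, pderiv_X]
      by_cases hk : i = k
      · subst hk
        rw [Pi.single_eq_same, map_one]
      · rw [Pi.single_eq_of_ne' hk, map_zero]
    rw [map_mul T, hT, bind₁_X_right, ← hT, pderiv_mul, hp, pderiv_mul, map_add T, map_mul T, map_mul T, hT,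
      bind₁_X_right, ← hT, hX]

/-- Translation commutes with `∂^α`. [cite: BrandenHuh2019, §2.4 Lemma 2.20 (5)] -/
theorem iterPderiv_translate (a : σ → ℝ) (α : σ →₀ ℕ) (f : MvPolynomial σ ℝ) :
    iterPderiv α (translate a f) = translate a (iterPderiv α f) := by
  classical
  obtain ⟨n, hn⟩ : ∃ n, α.degree = n := ⟨_, rfl⟩
  induction n generalizing α with
  | zero =>
    rw [Finsupp.degree_eq_zero_iff] at hn
    rw [hn, iterPderiv_zero, iterPderiv_zero]
  | succ n ih =>
    have hα0 : α ≠ 0 := fun h ↦ by rw [h, map_zero] at hn; exact Nat.succ_ne_zero n hn.symm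
    obtain ⟨i, hi⟩ : ∃ i, α i ≠ 0 := by
      by_contra h
      push Not at h
      exact hα0 (Finsupp.ext h)
    have hsplit : α = (α - Finsupp.single i 1) + Finsupp.single i 1 := by
      ext k
      rw [Finsupp.add_apply, Finsupp.tsub_apply, Finsupp.single_apply]
      split_ifs with hk
      · subst hk; omega
      · omega
    have hdeg : (α - Finsupp.single i 1).degree = n := by
      have h := degree_sub_single_add_one hi
      omega
    rw [hsplit, iterPderiv_add_single, iterPderiv_add_single, ih _ hdeg, pderiv_translate]

omit [Fintype σ] in
/-- Products of polynomials with nonnegative coefficients have nonnegative coefficients.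
[cite: BrandenHuh2019, §2.4 Lemma 2.20 (5)] -/
private theorem coeff_mul_nonneg' {p q : MvPolynomial σ ℝ} (hp : ∀ β, 0 ≤ coeff β p) (hq : ∀ β, 0 ≤ coeff β q)
    (β : σ →₀ ℕ) : 0 ≤ coeff β (p * q) := by
  classical
  rw [coeff_mul]
  exact Finset.sum_nonneg fun x _ ↦ mul_nonneg (hp _) (hq _)

omit [Fintype σ] in
/-- Powers of `X_i + C a`, `a ≥ 0`, have nonnegative coefficients. [cite: BrandenHuh2019, §2.4 Lemma 2.20 (5)] -/
private theorem coeff_X_add_C_pow_nonneg {a : ℝ} (ha : 0 ≤ a) (i : σ) (m : ℕ) (β : σ →₀ ℕ) :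
    0 ≤ coeff β ((X i + C a : MvPolynomial σ ℝ) ^ m) := by
  classical
  induction m generalizing β with
  | zero => rw [pow_zero, ← C_1, coeff_C]; split_ifs <;> norm_num
  | succ m ih =>
    rw [pow_succ]
    refine coeff_mul_nonneg' ih (fun γ ↦ ?_) β
    rw [coeff_add, ← pow_one (X i), coeff_X_pow, coeff_C]
    split_ifs <;> linarith

omit [Fintype σ] in
/-- A finite product of polynomials with nonnegative coefficients has nonnegative coefficients.
[cite: BrandenHuh2019, §2.4 Lemma 2.20 (5)] -/
private theorem coeff_finsuppProd_nonneg {a : σ → ℝ} (ha : ∀ i, 0 ≤ a i) (γ : σ →₀ ℕ) (β : σ →₀ ℕ) :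
    0 ≤ coeff β (γ.prod fun i k ↦ (X i + C (a i) : MvPolynomial σ ℝ) ^ k) := by
  classical
  rw [Finsupp.prod]
  induction γ.support using Finset.induction_on generalizing β with
  | empty => rw [Finset.prod_empty, ← C_1, coeff_C]; split_ifs <;> norm_num
  | insert k s hk ih =>
    rw [Finset.prod_insert hk]
    exact coeff_mul_nonneg' (coeff_X_add_C_pow_nonneg (ha k) k _) ih β

omit [Fintype σ] in
/-- **Translation by `a ≥ 0` keeps nonnegative coefficients** (`f(w + a) = Σ_γ c_γ Π_i (w_i + a_i)^{γ_i}`).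
[cite: BrandenHuh2019, §2.4 Lemma 2.20 (5)] -/
theorem coeff_translate_nonneg {a : σ → ℝ} (ha : ∀ i, 0 ≤ a i) {f : MvPolynomial σ ℝ} (hnn : ∀ β, 0 ≤ coeff β f)
    (β : σ →₀ ℕ) : 0 ≤ coeff β (translate a f) := by
  classical
  rw [translate, f.as_sum, map_sum, coeff_sum]
  refine Finset.sum_nonneg fun γ _ ↦ ?_
  rw [bind₁_monomial, coeff_C_mul]
  exact mul_nonneg (hnn γ) (coeff_finsuppProd_nonneg ha γ β)

/-- **Lemma 2.20 (5): the translation `f(a_1 + w_1, …, a_n + w_n)`, `a ∈ ℝ^n_{≥0}`, of a `c`-Rayleigh polynomial is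
`c`-Rayleigh** (Def. 2.18 for the translation at `w ≥ 0` is Def. 2.18 for `f` at `w + a ≥ 0`, as `∂^α` commutes with
translation). [cite: BrandenHuh2019, §2.4 Lemma 2.20 (5)] -/
theorem IsCRayleigh.translate {c : ℝ} {f : MvPolynomial σ ℝ} (h : IsCRayleigh c f) {a : σ → ℝ} (ha : ∀ i, 0 ≤ a i) :
    IsCRayleigh c (translate a f) := by
  refine ⟨coeff_translate_nonneg ha h.1, fun α i j w hw ↦ ?_⟩
  simp only [iterPderiv_translate, eval_translate]
  exact h.le α i j fun k ↦ add_nonneg (hw k) (ha k)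

end Translation

end Literature.Combinatorics.LorentzianPolynomials

end
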